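import Mathlib
import HarnessLib
import Literature.Analysis.FluidPDE.PalasekObukhovBarriers

/-!
# P-TOWER-1′ dictionary: the window constant `c* = ½ ln(4/3)` is exactly the boundary of the
# hypothesis of Palasek's Lemma 3.2 (eta_quarter_bound), and `rate × duration = amount`

HONEST FRAMING (cell `ns-blowup`, seat `ns-blowup-instab2`; human ruling D-0035): nothing here is a
claim about Navier–Stokes blow-up. WHAT THIS IS NOT: not NS; it is the arithmetic behind the P-TOWER-1′
normalisations OF RECORD (`HOME/instab2/NORMALISATIONS-OF-RECORD.md`, planner DECISION l.718), i.e.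
behind a MODEL experiment's registered threshold, kernel-checked so that the SPEC can cite names:

* `eta_ge_mul_exp_neg_two_mul` — the RATE-FREE form of the lower-barrier bound used in the proof of
  Lemma 3.2 of S. Palasek, arXiv:2605.13827 (p. 9: on a window of length `c/A_{k−1}` below `t = 0`, with
  the previous barrier `≤ 2A_{k−1}`, one has `η_k ≥ A_k e^{−2c}` for EVERY `c`), stated against the tree's
  transcription `Literature.Analysis.FluidPDE.PalasekObukhov.eta` (`PalasekObukhovBarriers.lean`);
* `palasek_hyp_iff_le_cstar` — the hypothesis `3/4 ≤ e^{−2c}` of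
  `PalasekObukhov.eta_ge_three_quarters` (the printed "(eta_quarter_bound) by the choice of `c > 0`")
  holds IFF `c ≤ c* := ½ ln(4/3)`; `eta_ge_three_quarters_of_le_cstar` restates the Literature lemma
  with the SPEC's hypothesis `c ≤ c*`; `cstar_window`: `0.1438 < c* < 0.1439` (the SPEC prints 0.1438);
* `quarter_lt_exp_iff_lt_log_two`, `cstar_lt_log_two`, `log_two_window` — the ARITHMETIC of the
  structural edge `c < ln 2` of `PTOWER-NORMALISATIONS.md` §3.8 (`e^{−2c} > ¼`): ONLY the edge's
  arithmetic is certified here; the re-tuning of the barrier construction for `c < ln 2` is a MODEL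
  reading of the proof architecture (refuter2 K-CONFIRM l.728), not formalised;
* `chi_min_mul_window`, `sigma_mul_phi_host` — the N3 self-consistency that drove DECISION l.718:
  `χ_min(β, c, Re) · W(c, Re) = m_k(β, Re)` identically (`(16·2^{−β}/c)·Re^{(β−4)/2} · (c/4)·Re =
  4·2^{−β}·Re^{(β−2)/2}`: RATE × DURATION = AMOUNT at the SAME `c`), and `σ_α·Φ_host = √2·(π√2) = 2π`
  (so `χ_obs = slope/(2π)` per host turnover).

LABEL: MODEL dictionary bookkeeping (CLAIM I1, refuter2 K-audit AGREE-EXACT l.712); METER 0.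
-/

namespace Summit.NavierStokesRegularity.FluidComputer.PTowerWindowConstant

open Real Set MeasureTheory intervalIntegral
open Literature.Analysis.FluidPDE

/-! ### The rate-free lower-barrier bound and the boundary of Palasek's hypothesis -/

/-- **Rate-free (eta bound).** On the child window `t ∈ [−c/A_{k−1}, 0]`, if the previous barrier obeys
`0 ≤ ζ_{k−1} ≤ 2A_{k−1}`, then `∫_t^0 ζ_{k−1} ≤ 2c` and hence `η_k(t) ≥ A_k e^{−2c}` — for EVERY window
constant `c`, with no condition on `c` (Palasek 2026, proof of Lemma 3.2, p. 9; the tree's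
`PalasekObukhov.eta_ge_three_quarters` is this followed by `e^{−2c} ≥ 3/4`). -/
theorem eta_ge_mul_exp_neg_two_mul {Ak Aprev c : ℝ} (hAk : 0 ≤ Ak) (hAprev : 0 < Aprev)
    {ζprev : ℝ → ℝ} {t : ℝ} (ht0 : t ≤ 0) (htk1 : -(c / Aprev) ≤ t)
    (hint : IntervalIntegrable ζprev volume t 0)
    (hprev : ∀ s ∈ Icc t 0, 0 ≤ ζprev s ∧ ζprev s ≤ 2 * Aprev) :
    Ak * Real.exp (-(2 * c)) ≤ PalasekObukhov.eta Ak ζprev t := by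
  have hI : ∫ s in t..0, ζprev s ≤ 2 * c := by
    calc ∫ s in t..0, ζprev s ≤ ∫ s in t..0, (2 * Aprev : ℝ) :=
          integral_mono_on ht0 hint intervalIntegrable_const fun s hs => (hprev s hs).2
      _ = (0 - t) * (2 * Aprev) := by rw [intervalIntegral.integral_const, smul_eq_mul]
      _ ≤ c / Aprev * (2 * Aprev) := by nlinarith
      _ = 2 * c := by field_simp
  exact PalasekObukhov.eta_ge_of_integral_le hAk hI

/-- **`c* = ½ ln(4/3)` is exactly the boundary of Palasek's hypothesis:** `3/4 ≤ e^{−2c} ↔ c ≤ ln(4/3)/2`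
(the hypothesis `hc` of `PalasekObukhov.eta_ge_three_quarters`; planner DECISION l.718 (1) «printed-maximal
constant of record»). -/
theorem palasek_hyp_iff_le_cstar (c : ℝ) :
    (3 / 4 : ℝ) ≤ Real.exp (-(2 * c)) ↔ c ≤ Real.log (4 / 3) / 2 := by
  have h34 : Real.log (3 / 4 : ℝ) = -Real.log (4 / 3) := by
    rw [← Real.log_inv]; norm_num
  rw [← Real.log_le_iff_le_exp (by norm_num : (0 : ℝ) < 3 / 4), h34]
  constructor <;> intro h <;> linarith

/-- Palasek's (eta_quarter_bound) `η_k ≥ ¾A_k` on the child window, with the SPEC's hypothesis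
`c ≤ c* = ½ ln(4/3)` in place of `e^{−2c} ≥ 3/4` (direct from the Literature lemma). -/
theorem eta_ge_three_quarters_of_le_cstar {Ak Aprev c : ℝ} (hAk : 0 ≤ Ak) (hAprev : 0 < Aprev)
    (hc : c ≤ Real.log (4 / 3) / 2) {ζprev : ℝ → ℝ} {t : ℝ} (ht0 : t ≤ 0)
    (htk1 : -(c / Aprev) ≤ t) (hint : IntervalIntegrable ζprev volume t 0)
    (hprev : ∀ s ∈ Icc t 0, 0 ≤ ζprev s ∧ ζprev s ≤ 2 * Aprev) :
    3 / 4 * Ak ≤ PalasekObukhov.eta Ak ζprev t :=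
  PalasekObukhov.eta_ge_three_quarters hAk hAprev ((palasek_hyp_iff_le_cstar c).2 hc) ht0 htk1 hint hprev

/-- Numerics for the window of `c*`: `e^{0.2876} < 4/3` (five Taylor terms + Lagrange tail, `Real.exp_bound'`). -/
theorem exp_02876_lt : Real.exp (719 / 2500) < 4 / 3 := by
  calc Real.exp (719 / 2500)
      ≤ (∑ m ∈ Finset.range 5, (719 / 2500 : ℝ) ^ m / m.factorial) +
          (719 / 2500 : ℝ) ^ 5 * (5 + 1) / (Nat.factorial 5 * 5) :=
        Real.exp_bound' (by norm_num) (by norm_num) (by norm_num)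
    _ < 4 / 3 := by norm_num [Finset.sum_range_succ, Nat.factorial]

/-- `4/3 < e^{0.2878}` (five Taylor terms − Lagrange tail, from the two-sided `Real.exp_bound`). -/
theorem lt_exp_02878 : (4 / 3 : ℝ) < Real.exp (1439 / 5000) := by
  have h := Real.exp_bound (x := (1439 / 5000 : ℝ)) (by rw [abs_of_pos (by norm_num)]; norm_num)
    (n := 5) (by norm_num)
  rw [abs_of_pos (by norm_num : (0 : ℝ) < 1439 / 5000)] at h
  have h' := (abs_sub_le_iff.1 h).2
  have hS : (4 / 3 : ℝ) < (∑ m ∈ Finset.range 5, (1439 / 5000 : ℝ) ^ m / m.factorial) -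
      (1439 / 5000 : ℝ) ^ 5 * ((Nat.succ 5 : ℕ) / ((Nat.factorial 5 : ℕ) * (5 : ℕ) : ℝ)) := by
    norm_num [Finset.sum_range_succ, Nat.factorial]
  linarith

/-- **The SPEC's printed value:** `0.1438 < c* = ½ ln(4/3) < 0.1439` (true `0.143841…`). -/
theorem cstar_window : (0.1438 : ℝ) < Real.log (4 / 3) / 2 ∧ Real.log (4 / 3) / 2 < 0.1439 := by
  constructor
  · have h : (719 / 2500 : ℝ) < Real.log (4 / 3) := by
      rw [Real.lt_log_iff_exp_lt (by norm_num)]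
      exact exp_02876_lt
    have : (0.1438 : ℝ) = 719 / 2500 / 2 := by norm_num
    linarith
  · have h : Real.log (4 / 3) < (1439 / 5000 : ℝ) := by
      rw [Real.log_lt_iff_lt_exp (by norm_num)]
      exact lt_exp_02878
    have : (0.1439 : ℝ) = 1439 / 5000 / 2 := by norm_num
    linarith

/-! ### The structural edge `c < ln 2` (arithmetic only) -/

/-- `¼ < e^{−2c} ↔ c < ln 2` — the arithmetic of the MODEL structural edge of PTOWER-NORMALISATIONS
§3.8 (at the margin `N_k² = ¼A_{k−1}` the upper-barrier crossing needs `e^{−2c} − ¼ > 0`); the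
re-tuning argument itself is NOT formalised here. -/
theorem quarter_lt_exp_iff_lt_log_two (c : ℝ) :
    (1 / 4 : ℝ) < Real.exp (-(2 * c)) ↔ c < Real.log 2 := by
  have h14 : Real.log (1 / 4 : ℝ) = -(2 * Real.log 2) := by
    rw [one_div, Real.log_inv, show (4 : ℝ) = 2 ^ 2 by norm_num, Real.log_pow]
    push_cast
    ring
  rw [← Real.log_lt_iff_lt_exp (by norm_num : (0 : ℝ) < 1 / 4), h14]
  constructor <;> intro h <;> linarith

/-- The printed band sits strictly inside the structural one: `c* = ½ ln(4/3) < ln 2`. -/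
theorem cstar_lt_log_two : Real.log (4 / 3) / 2 < Real.log 2 := by
  have h1 := cstar_window.2
  have h2 : (0.6931471803 : ℝ) < Real.log 2 := Real.log_two_gt_d9
  linarith

/-- The edge's printed value: `0.6931471803 < ln 2 < 0.6931471808` (Mathlib). -/
theorem log_two_window : (0.6931471803 : ℝ) < Real.log 2 ∧ Real.log 2 < 0.6931471808 :=
  ⟨Real.log_two_gt_d9, Real.log_two_lt_d9⟩

/-! ### `rate × duration = amount` and `σ_α Φ_host = 2π` -/

/-- **N3 self-consistency (planner l.671/l.718):** with `χ_min(β,c,Re) = (16·2^{−β}/c)·Re^{(β−4)/2}`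
host fluxes per host turnover and the tower window `W(c,Re) = (c/4)·Re` host turnovers,
`χ_min · W = 4·2^{−β}·Re^{(β−2)/2} = m_k` for every `β`, every `c ≠ 0`, every `Re > 0`: reading RATE and
DURATION at the SAME `c` encodes exactly ONE amount. -/
theorem chi_min_mul_window (β c Re : ℝ) (hc : c ≠ 0) (hRe : 0 < Re) :
    (16 * (2 : ℝ) ^ (-β) / c * Re ^ ((β - 4) / 2)) * (c / 4 * Re) = 4 * (2 : ℝ) ^ (-β) * Re ^ ((β - 2) / 2) := by
  have h : Re ^ ((β - 4) / 2) * Re = Re ^ ((β - 2) / 2) := by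
    rw [show (β - 2) / 2 = (β - 4) / 2 + 1 by ring, Real.rpow_add hRe, Real.rpow_one]
  calc (16 * (2 : ℝ) ^ (-β) / c * Re ^ ((β - 4) / 2)) * (c / 4 * Re)
      = 4 * (2 : ℝ) ^ (-β) * (Re ^ ((β - 4) / 2) * Re) * (c / c) := by ring
    _ = 4 * (2 : ℝ) ^ (-β) * Re ^ ((β - 2) / 2) := by rw [h, div_self hc, mul_one]

/-- The AMOUNT is window-constant-free: `m_k` does not depend on `c` (trivial but cited: moving `c`
trades rate against duration, never the amount). -/
theorem chi_min_mul_window_indep (β c₁ c₂ Re : ℝ) (h₁ : c₁ ≠ 0) (h₂ : c₂ ≠ 0) (hRe : 0 < Re) :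
    (16 * (2 : ℝ) ^ (-β) / c₁ * Re ^ ((β - 4) / 2)) * (c₁ / 4 * Re) =
      (16 * (2 : ℝ) ^ (-β) / c₂ * Re ^ ((β - 4) / 2)) * (c₂ / 4 * Re) := by
  rw [chi_min_mul_window β c₁ Re h₁ hRe, chi_min_mul_window β c₂ Re h₂ hRe]

/-- `σ_α · Φ_host = √2 · (π√2) = 2π`: one host flux per host turnover is a slope of `2π` code units
(card §2: `χ_obs := slope/(2π)`). -/
theorem sigma_mul_phi_host : Real.sqrt 2 * (Real.pi * Real.sqrt 2) = 2 * Real.pi := by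
  have h : Real.sqrt 2 * Real.sqrt 2 = 2 := Real.mul_self_sqrt (by norm_num)
  calc Real.sqrt 2 * (Real.pi * Real.sqrt 2) = (Real.sqrt 2 * Real.sqrt 2) * Real.pi := by ring
    _ = 2 * Real.pi := by rw [h]


section CaptureFactor

/-! ### The disc-capture factor of the card (§2): `Γ(R)/Γ_∞ = 1 − e^{−R²/a²}` for a Gaussian core,
printed beside every AMOUNT word (0.895 at `a = 2r_c`, 0.836 at `a = 2.23 r_c`, disc radius `3r_c`). -/
/-- Antiderivative: `d/dr [−(a²/2) e^{−r²/a²}] = r e^{−r²/a²}` (`a ≠ 0`). -/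
theorem hasDerivAt_gauss_prim {a : ℝ} (ha : a ≠ 0) (r : ℝ) :
    HasDerivAt (fun ρ : ℝ => -(a ^ 2 / 2) * Real.exp (-ρ ^ 2 / a ^ 2)) (r * Real.exp (-r ^ 2 / a ^ 2)) r := by
  have h1 : HasDerivAt (fun ρ : ℝ => -ρ ^ 2 / a ^ 2) (-(2 * r) / a ^ 2) r := by
    have h := ((hasDerivAt_pow 2 r).neg).div_const (a ^ 2)
    simpa using h
  have h2 : HasDerivAt (fun ρ : ℝ => Real.exp (-ρ ^ 2 / a ^ 2))
      (Real.exp (-r ^ 2 / a ^ 2) * (-(2 * r) / a ^ 2)) r := h1.exp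
  have h3 := h2.const_mul (-(a ^ 2 / 2))
  refine h3.congr_deriv ?_
  field_simp

/-- **Disc-capture factor (card §2, EXACT for a Gaussian core).** The circulation of the Gaussian
vorticity profile `ω(r) = ω₀ e^{−r²/a²}` inside radius `R` is
`∫₀^R ω₀ e^{−r²/a²} · 2πr dr = π a² ω₀ (1 − e^{−R²/a²})`; with total circulation `Γ_∞ = π a² ω₀` the
captured fraction through a disc of radius `R` is `1 − e^{−R²/a²}` (= 0.895 at `R = 3r_c`, `a = 2r_c`;
0.836 at `a = 2.23 r_c`). -/
theorem gaussian_disc_circulation {a : ℝ} (ha : a ≠ 0) (ω₀ R : ℝ) :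
    ∫ r in (0 : ℝ)..R, ω₀ * Real.exp (-r ^ 2 / a ^ 2) * (2 * Real.pi * r)
      = Real.pi * a ^ 2 * ω₀ * (1 - Real.exp (-R ^ 2 / a ^ 2)) := by
  have hderiv : ∀ x ∈ uIcc (0 : ℝ) R,
      HasDerivAt (fun ρ : ℝ => 2 * Real.pi * ω₀ * (-(a ^ 2 / 2) * Real.exp (-ρ ^ 2 / a ^ 2)))
        (ω₀ * Real.exp (-x ^ 2 / a ^ 2) * (2 * Real.pi * x)) x := by
    intro x _
    exact ((hasDerivAt_gauss_prim ha x).const_mul (2 * Real.pi * ω₀)).congr_deriv (by ring)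
  have hint : IntervalIntegrable (fun r : ℝ => ω₀ * Real.exp (-r ^ 2 / a ^ 2) * (2 * Real.pi * r))
      volume (0 : ℝ) R :=
    (by fun_prop : Continuous fun r : ℝ => ω₀ * Real.exp (-r ^ 2 / a ^ 2) * (2 * Real.pi * r)).intervalIntegrable _ _
  rw [integral_eq_sub_of_hasDerivAt hderiv hint]
  simp
  ring

/-- Captured FRACTION: dividing by `Γ_∞ = π a² ω₀` (`ω₀ ≠ 0`), the disc of radius `R` holds
`1 − e^{−R²/a²}` of the tube's circulation. -/
theorem gaussian_capture_fraction {a ω₀ : ℝ} (ha : a ≠ 0) (hω : ω₀ ≠ 0) (R : ℝ) :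
    (∫ r in (0 : ℝ)..R, ω₀ * Real.exp (-r ^ 2 / a ^ 2) * (2 * Real.pi * r)) / (Real.pi * a ^ 2 * ω₀)
      = 1 - Real.exp (-R ^ 2 / a ^ 2) := by
  rw [gaussian_disc_circulation ha ω₀ R]
  have hpi : Real.pi ≠ 0 := Real.pi_ne_zero
  field_simp

/-- The two printed values: at `R = 3r_c` with `a = 2r_c` the exponent is `R²/a² = 9/4` and
`0.894 < 1 − e^{−9/4} < 0.895`; (the card's 0.8946). -/
theorem capture_at_two_rc : (0.894 : ℝ) < 1 - Real.exp (-(9 / 4 : ℝ)) ∧ 1 - Real.exp (-(9 / 4 : ℝ)) < 0.8947 := by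
  -- e^{-9/4} = (e^{-3/4})^3 ; bound e^{3/4} two-sidedly with Real.exp_bound
  have h := Real.exp_bound (x := (3 / 4 : ℝ)) (by rw [abs_of_pos (by norm_num)]; norm_num) (n := 8) (by norm_num)
  rw [abs_of_pos (by norm_num : (0 : ℝ) < 3 / 4)] at h
  have hlo := (abs_sub_le_iff.1 h).2
  have hhi := (abs_sub_le_iff.1 h).1
  have hU : Real.exp (3 / 4 : ℝ) < 2.11701 := by
    have : (∑ m ∈ Finset.range 8, (3 / 4 : ℝ) ^ m / m.factorial) +
        (3 / 4 : ℝ) ^ 8 * ((Nat.succ 8 : ℕ) / ((Nat.factorial 8 : ℕ) * (8 : ℕ) : ℝ)) < 2.11701 := by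
      norm_num [Finset.sum_range_succ, Nat.factorial]
    linarith
  have hL : (2.11699 : ℝ) < Real.exp (3 / 4 : ℝ) := by
    have : (2.11699 : ℝ) < (∑ m ∈ Finset.range 8, (3 / 4 : ℝ) ^ m / m.factorial) -
        (3 / 4 : ℝ) ^ 8 * ((Nat.succ 8 : ℕ) / ((Nat.factorial 8 : ℕ) * (8 : ℕ) : ℝ)) := by
      norm_num [Finset.sum_range_succ, Nat.factorial]
    linarith
  have hE : Real.exp (-(9 / 4 : ℝ)) = (Real.exp (3 / 4 : ℝ))⁻¹ ^ 3 := by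
    rw [← Real.exp_neg, ← Real.exp_nat_mul]; norm_num
  have hpos : 0 < Real.exp (3 / 4 : ℝ) := Real.exp_pos _
  have hinvU : (Real.exp (3 / 4 : ℝ))⁻¹ < (2.11699 : ℝ)⁻¹ := by
    rw [inv_lt_inv₀ hpos (by norm_num)]; exact hL
  have hinvL : (2.11701 : ℝ)⁻¹ < (Real.exp (3 / 4 : ℝ))⁻¹ := by
    rw [inv_lt_inv₀ (by norm_num) hpos]; exact hU
  have hinv0 : 0 < (Real.exp (3 / 4 : ℝ))⁻¹ := inv_pos.2 hpos
  rw [hE]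
  constructor
  · have h3 : (Real.exp (3 / 4 : ℝ))⁻¹ ^ 3 < (2.11699 : ℝ)⁻¹ ^ 3 :=
      pow_lt_pow_left₀ hinvU hinv0.le (by norm_num)
    have : ((2.11699 : ℝ)⁻¹) ^ 3 < 0.106 := by norm_num
    linarith
  · have h3 : (2.11701 : ℝ)⁻¹ ^ 3 < (Real.exp (3 / 4 : ℝ))⁻¹ ^ 3 :=
      pow_lt_pow_left₀ hinvL (by norm_num) (by norm_num)
    have : (0.1053 : ℝ) < ((2.11701 : ℝ)⁻¹) ^ 3 := by norm_num
    linarith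

end CaptureFactor

end Summit.NavierStokesRegularity.FluidComputer.PTowerWindowConstant
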